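import Summits.AnomalousDissipation.AnomalousDissipation.Theorems.EnsembleRigidityDefs
import Literature.Analysis.FluidPDE.StatisticalSolutionEnergyEq
import Literature.Analysis.FluidPDE.StatisticalSolutionProofs
import HarnessLib

/-!
# Stub L′ `stub_galerkinLadderLocal` of line `floor-duality-galerkin` (crux stmt-AnomalousDissipation-18400,
# `TameRoughRigidity.GPEulerCoercive`) — negative side: COOL INVARIANT MEASURES OF THE TRUNCATION KILL THE RUNG

cdisprove seat `refuter-cdisprove-stmt-AnomalousDissipation-18400-0`, cycle 1 (2026-08-17). The open stub L′ asks, for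
every level `Γ`, for a resolution `M`, a state-dependent strain budget `S : H → [0, λ_M)` (`λ_M = 4π²(M²+1)`) and a
cylindrical `Ψ` with the Galerkin certificate

  `Γ + S(y)²|y|²/(λ_M − S(y)) ≤ ‖∇y‖² + ⟨f − B(y,y), Ψ'(y)⟩`   for all `y ∈ H ∩ galerkinSpace M`.

Kernel-checked here (nothing asserts a Theses statement; no definition is introduced):

* `galerkinCertificate_le_meanEnstrophy` — THE NECESSARY CONDITION, measure by measure. If `ρ` is a probability
  measure on `H` carried by `galerkinSpace M`, of finite mean enstrophy, which kills the generator image of the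
  certificate's own functional, `∫⟨f − B(y,y), Ψ'(y)⟩ dρ = 0` (every invariant probability measure of the
  `M`-Galerkin forced Euler ODE `ẏ = P_M f − P_M B(y,y)` with finite second moments does so for every low-mode `Ψ`:
  Dirac masses at steady Galerkin dodgers, normalised length measure on periodic orbits, Haar measure on invariant
  tori, SRB-type measures), then `Γ ≤ ∫ ‖∇y‖² dρ`. The strain budget only enters through the SIGN of the penalty.
* `no_galerkinCertificate_of_cool` — contrapositive: ONE such `ρ` with `∫‖∇y‖² dρ < Γ` excludes every certificate
  `(S, Ψ)` of resolution `M` at level `Γ` whose functional `ρ` annihilates.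
* `not_galerkinLadderLocal_of_coolFamily` — hence a family `(ρ_M)_{M ∈ ℕ}` of such measures, `ρ_M` invariant (in the
  weak sense above, for ALL low-mode cylindrical `Ψ` of order `M`) and UNIFORMLY COOL (`∫‖∇y‖² dρ_M < Γ₀` for one
  `Γ₀` and all `M`), refutes the conclusion of L′ at level `Γ₀` for EVERY force `f` — the exact shape of the line's
  falsifier ("Galerkin forced Euler CAN stay cool").
* `galerkinCertificate_le_enstrophy_of_steadyGalerkin` — the Dirac instance: every finite-enstrophy state `y⋆ ∈ galerkinSpace M`
  annihilated by the certificate's differential (`⟨f − B(y⋆,y⋆), Ψ'(y⋆)⟩ = 0`; every STEADY GALERKIN DODGER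
  `P_M B(y⋆,y⋆) = P_M f` is annihilated by every low-mode `Ψ`) bounds the rung: `Γ ≤ ‖∇y⋆‖²`. So the census observable
  `G_min(M)` (minimal enstrophy of steady dodgers of the `M`-truncation) is a CEILING for the rungs of resolution `M`:
  `Γ*(M) ≤ G_min(M)`; rungs can only climb as fast as the steady dodgers heat up (j020739: `82 → 436` over `|k|² ≤ 2 … 14`;
  this seat's even dodgers at `|k|² ≤ 4`: `351.9, 648.7`, smoke j025742 — not a minimum search). For `f_GP` none is known: resolution `M = 1` carries no
  invariant probability measure at all (`ẏ = f_GP`), the steady dodgers of the census heat up (`G_min = 82 → 436`,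
  j020739, `|k|² ≤ 14`), random data heat (j023318); the reversible-periodic-orbit search of this seat (kit j026015:
  symmetric periodic orbits of the truncations `|k|² ≤ 2, 3, 4, 9` via the reversing symmetry
  `S = (t ↦ −t) ∘ (x ↦ −x)`, whose fixed space — the cosine fields — has half the dimension, so that `S`-symmetric
  periodic orbits come in one-parameter families) tabulates the coolest periodic invariant measures found.
-/

set_option linter.dupNamespace false

noncomputable section

namespace Summit.AnomalousDissipation.AnomalousDissipation.Theorems.GPEulerCoercive.Negative

open MeasureTheory Filter Topology UnitAddTorus
open scoped InnerProductSpace RealInnerProductSpace ENNReal NNReal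
open Literature.Analysis.FunctionSpaces Literature.Analysis.FluidPDE

/-- **Necessary condition of a Galerkin certificate (stub L′), measure by measure.** A probability measure on `H`
carried by `galerkinSpace M`, of finite mean enstrophy, annihilating the generator image of the certificate's
functional, has mean enstrophy `≥ Γ`. (Of the strain budget only `S < λ_M`, i.e. penalty `≥ 0`, is used.) -/
theorem galerkinCertificate_le_meanEnstrophy
    (f : UnitAddTorus (Fin 3) → EuclideanSpace ℝ (Fin 3)) (M : ℕ) (Γ : ℝ)
    (S : Torus.energySpace (Fin 3) → ℝ) (Ψ : Torus.CylindricalTest (Fin 3))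
    (hSM : ∀ v : Torus.energySpace (Fin 3), S v < 4 * Real.pi ^ 2 * ((M : ℝ) ^ 2 + 1))
    (hgal : ∀ y : Torus.energySpace (Fin 3),
      (y : Lp (EuclideanSpace ℝ (Fin 3)) 2 (volume : Measure (UnitAddTorus (Fin 3)))) ∈
        (Torus.galerkinSpace M : Submodule ℝ (Lp (EuclideanSpace ℝ (Fin 3)) 2 (volume : Measure (UnitAddTorus (Fin 3))))) →
      Γ + S y ^ 2 * ‖y‖ ^ 2 / (4 * Real.pi ^ 2 * ((M : ℝ) ^ 2 + 1) - S y) ≤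
        (Torus.eGradNormSq ((y : Lp (EuclideanSpace ℝ (Fin 3)) 2 (volume : Measure (UnitAddTorus (Fin 3)))) :
          UnitAddTorus (Fin 3) → EuclideanSpace ℝ (Fin 3))).toReal + Torus.nsGeneratorPairing 0 f y (Ψ.grad y))
    (ρ : Measure (Torus.energySpace (Fin 3))) [IsProbabilityMeasure ρ]
    (hsupp : ∀ᵐ y ∂ρ, ((y : Torus.energySpace (Fin 3)) : Lp (EuclideanSpace ℝ (Fin 3)) 2 (volume : Measure (UnitAddTorus (Fin 3)))) ∈
        (Torus.galerkinSpace M : Submodule ℝ (Lp (EuclideanSpace ℝ (Fin 3)) 2 (volume : Measure (UnitAddTorus (Fin 3))))))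
    (hfin : ∫⁻ y, Torus.eGradNormSq ((y : Lp (EuclideanSpace ℝ (Fin 3)) 2 (volume : Measure (UnitAddTorus (Fin 3)))) :
        UnitAddTorus (Fin 3) → EuclideanSpace ℝ (Fin 3)) ∂ρ < ∞)
    (hinv : Integrable (fun y : Torus.energySpace (Fin 3) => Torus.nsGeneratorPairing 0 f y (Ψ.grad y)) ρ ∧
      ∫ y, Torus.nsGeneratorPairing 0 f y (Ψ.grad y) ∂ρ = 0) :
    ENNReal.ofReal Γ ≤ ∫⁻ y, Torus.eGradNormSq ((y : Lp (EuclideanSpace ℝ (Fin 3)) 2 (volume : Measure (UnitAddTorus (Fin 3)))) :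
        UnitAddTorus (Fin 3) → EuclideanSpace ℝ (Fin 3)) ∂ρ := by
  -- the enstrophy density: measurable, finite a.e., integrable
  have hGm : Measurable fun u : Torus.energySpace (Fin 3) =>
      Torus.eGradNormSq ((u : Lp (EuclideanSpace ℝ (Fin 3)) 2 (volume : Measure (UnitAddTorus (Fin 3)))) :
        UnitAddTorus (Fin 3) → EuclideanSpace ℝ (Fin 3)) :=
    Torus.measurable_eGradNormSq_coe
  have hGlt : ∀ᵐ u ∂ρ, Torus.eGradNormSq (((u : Torus.energySpace (Fin 3)) : Lp (EuclideanSpace ℝ (Fin 3)) 2 (volume : Measure (UnitAddTorus (Fin 3)))) :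
      UnitAddTorus (Fin 3) → EuclideanSpace ℝ (Fin 3)) < ⊤ := ae_lt_top hGm hfin.ne
  have haI : Integrable (fun u : Torus.energySpace (Fin 3) =>
      (Torus.eGradNormSq ((u : Lp (EuclideanSpace ℝ (Fin 3)) 2 (volume : Measure (UnitAddTorus (Fin 3)))) :
        UnitAddTorus (Fin 3) → EuclideanSpace ℝ (Fin 3))).toReal) ρ :=
    integrable_toReal_of_lintegral_ne_top hGm.aemeasurable hfin.ne
  have hGa : ∫ u, (Torus.eGradNormSq ((u : Lp (EuclideanSpace ℝ (Fin 3)) 2 (volume : Measure (UnitAddTorus (Fin 3)))) :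
      UnitAddTorus (Fin 3) → EuclideanSpace ℝ (Fin 3))).toReal ∂ρ =
      (∫⁻ y, Torus.eGradNormSq ((y : Lp (EuclideanSpace ℝ (Fin 3)) 2 (volume : Measure (UnitAddTorus (Fin 3)))) :
        UnitAddTorus (Fin 3) → EuclideanSpace ℝ (Fin 3)) ∂ρ).toReal := by
    rw [integral_toReal hGm.aemeasurable hGlt]
  obtain ⟨hgenI, hgen0⟩ := hinv
  -- the certificate inequality with the penalty dropped, valid `ρ`-a.e. (on the Galerkin space)
  have hae : ∀ᵐ y ∂ρ,
      Γ ≤ (Torus.eGradNormSq (((y : Torus.energySpace (Fin 3)) : Lp (EuclideanSpace ℝ (Fin 3)) 2 (volume : Measure (UnitAddTorus (Fin 3)))) :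
        UnitAddTorus (Fin 3) → EuclideanSpace ℝ (Fin 3))).toReal + Torus.nsGeneratorPairing 0 f y (Ψ.grad y) := by
    filter_upwards [hsupp] with y hy
    have hpen : 0 ≤ S y ^ 2 * ‖y‖ ^ 2 / (4 * Real.pi ^ 2 * ((M : ℝ) ^ 2 + 1) - S y) :=
      div_nonneg (by positivity) (sub_nonneg.mpr (hSM y).le)
    linarith [hgal y hy]
  have hRI : Integrable (fun y : Torus.energySpace (Fin 3) =>
      (Torus.eGradNormSq ((y : Lp (EuclideanSpace ℝ (Fin 3)) 2 (volume : Measure (UnitAddTorus (Fin 3)))) :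
        UnitAddTorus (Fin 3) → EuclideanSpace ℝ (Fin 3))).toReal + Torus.nsGeneratorPairing 0 f y (Ψ.grad y)) ρ :=
    haI.add hgenI
  have hmono := integral_mono_ae (integrable_const Γ) hRI hae
  rw [integral_const, probReal_univ, one_smul, integral_add haI hgenI, hgen0, add_zero, hGa] at hmono
  exact ENNReal.ofReal_le_of_le_toReal hmono

/-- **A cool annihilating measure kills the rung.** One probability measure carried by `galerkinSpace M`, of mean
enstrophy `< Γ`, annihilating the generator image of `Ψ`, excludes every Galerkin certificate `(S, Ψ)` of
resolution `M` at level `Γ`. -/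
theorem no_galerkinCertificate_of_cool
    (f : UnitAddTorus (Fin 3) → EuclideanSpace ℝ (Fin 3)) (M : ℕ) (Γ : ℝ)
    (S : Torus.energySpace (Fin 3) → ℝ) (Ψ : Torus.CylindricalTest (Fin 3))
    (hSM : ∀ v : Torus.energySpace (Fin 3), S v < 4 * Real.pi ^ 2 * ((M : ℝ) ^ 2 + 1))
    (ρ : Measure (Torus.energySpace (Fin 3))) [IsProbabilityMeasure ρ]
    (hsupp : ∀ᵐ y ∂ρ, ((y : Torus.energySpace (Fin 3)) : Lp (EuclideanSpace ℝ (Fin 3)) 2 (volume : Measure (UnitAddTorus (Fin 3)))) ∈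
        (Torus.galerkinSpace M : Submodule ℝ (Lp (EuclideanSpace ℝ (Fin 3)) 2 (volume : Measure (UnitAddTorus (Fin 3))))))
    (hcool : ∫⁻ y, Torus.eGradNormSq ((y : Lp (EuclideanSpace ℝ (Fin 3)) 2 (volume : Measure (UnitAddTorus (Fin 3)))) :
        UnitAddTorus (Fin 3) → EuclideanSpace ℝ (Fin 3)) ∂ρ < ENNReal.ofReal Γ)
    (hinv : Integrable (fun y : Torus.energySpace (Fin 3) => Torus.nsGeneratorPairing 0 f y (Ψ.grad y)) ρ ∧
      ∫ y, Torus.nsGeneratorPairing 0 f y (Ψ.grad y) ∂ρ = 0) :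
    ¬ ∀ y : Torus.energySpace (Fin 3),
      (y : Lp (EuclideanSpace ℝ (Fin 3)) 2 (volume : Measure (UnitAddTorus (Fin 3)))) ∈
        (Torus.galerkinSpace M : Submodule ℝ (Lp (EuclideanSpace ℝ (Fin 3)) 2 (volume : Measure (UnitAddTorus (Fin 3))))) →
      Γ + S y ^ 2 * ‖y‖ ^ 2 / (4 * Real.pi ^ 2 * ((M : ℝ) ^ 2 + 1) - S y) ≤
        (Torus.eGradNormSq ((y : Lp (EuclideanSpace ℝ (Fin 3)) 2 (volume : Measure (UnitAddTorus (Fin 3)))) :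
          UnitAddTorus (Fin 3) → EuclideanSpace ℝ (Fin 3))).toReal + Torus.nsGeneratorPairing 0 f y (Ψ.grad y) := by
  intro hgal
  have hfin : ∫⁻ y, Torus.eGradNormSq ((y : Lp (EuclideanSpace ℝ (Fin 3)) 2 (volume : Measure (UnitAddTorus (Fin 3)))) :
      UnitAddTorus (Fin 3) → EuclideanSpace ℝ (Fin 3)) ∂ρ < ∞ := hcool.trans ENNReal.ofReal_lt_top
  exact absurd (galerkinCertificate_le_meanEnstrophy f M Γ S Ψ hSM hgal ρ hsupp hfin hinv) (not_le.mpr hcool)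

/-- **A uniformly cool family of invariant measures of the truncations refutes the conclusion of L′.** If for every
resolution `M` there is a probability measure `ρ_M` on `H` carried by `galerkinSpace M`, annihilating the generator
image of EVERY low-mode cylindrical functional of order `M` (weak invariance under the `M`-Galerkin forced Euler ODE)
with the integrand integrable, and `∫‖∇y‖² dρ_M < Γ₀` for one level `Γ₀` and all `M`, then no rung of the ladder
reaches `Γ₀` — for any force `f`. (The shape of the line's falsifier; for `f_GP` no such family is known.) -/
theorem not_galerkinLadderLocal_of_coolFamily
    (f : UnitAddTorus (Fin 3) → EuclideanSpace ℝ (Fin 3)) (Γ₀ : ℝ)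
    (hcool : ∀ M : ℕ, ∃ ρ : Measure (Torus.energySpace (Fin 3)), IsProbabilityMeasure ρ ∧
      (∀ᵐ y ∂ρ, ((y : Torus.energySpace (Fin 3)) : Lp (EuclideanSpace ℝ (Fin 3)) 2 (volume : Measure (UnitAddTorus (Fin 3)))) ∈
        (Torus.galerkinSpace M : Submodule ℝ (Lp (EuclideanSpace ℝ (Fin 3)) 2 (volume : Measure (UnitAddTorus (Fin 3)))))) ∧
      (∫⁻ y, Torus.eGradNormSq ((y : Lp (EuclideanSpace ℝ (Fin 3)) 2 (volume : Measure (UnitAddTorus (Fin 3)))) :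
        UnitAddTorus (Fin 3) → EuclideanSpace ℝ (Fin 3)) ∂ρ < ENNReal.ofReal Γ₀) ∧
      ∀ Ψ : Torus.CylindricalTest (Fin 3),
        (∀ (v : Lp (EuclideanSpace ℝ (Fin 3)) 2 (volume : Measure (UnitAddTorus (Fin 3)))) (i : Fin Ψ.m),
          Torus.pairing v (Ψ.g i) =
            Torus.pairing ((Torus.galerkinProj M : Lp (EuclideanSpace ℝ (Fin 3)) 2 (volume : Measure (UnitAddTorus (Fin 3))) →L[ℝ]
              Lp (EuclideanSpace ℝ (Fin 3)) 2 (volume : Measure (UnitAddTorus (Fin 3)))) v) (Ψ.g i)) →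
        Integrable (fun y : Torus.energySpace (Fin 3) => Torus.nsGeneratorPairing 0 f y (Ψ.grad y)) ρ ∧
          ∫ y, Torus.nsGeneratorPairing 0 f y (Ψ.grad y) ∂ρ = 0) :
    ¬ ∃ (M : ℕ) (S : Torus.energySpace (Fin 3) → ℝ) (Ψ : Torus.CylindricalTest (Fin 3)),
      (∀ (v : Lp (EuclideanSpace ℝ (Fin 3)) 2 (volume : Measure (UnitAddTorus (Fin 3)))) (i : Fin Ψ.m),
        Torus.pairing v (Ψ.g i) =
          Torus.pairing ((Torus.galerkinProj M : Lp (EuclideanSpace ℝ (Fin 3)) 2 (volume : Measure (UnitAddTorus (Fin 3))) →L[ℝ]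
            Lp (EuclideanSpace ℝ (Fin 3)) 2 (volume : Measure (UnitAddTorus (Fin 3)))) v) (Ψ.g i)) ∧
      (∀ (v : Torus.energySpace (Fin 3)) (x : UnitAddTorus (Fin 3)) (e : EuclideanSpace ℝ (Fin 3)),
        |⟪Torus.fderiv (Ψ.grad v) x e, e⟫_ℝ| ≤ S v * ‖e‖ ^ 2) ∧
      (∀ v : Torus.energySpace (Fin 3), 0 ≤ S v) ∧
      (∀ v : Torus.energySpace (Fin 3), S v < 4 * Real.pi ^ 2 * ((M : ℝ) ^ 2 + 1)) ∧
      ∀ y : Torus.energySpace (Fin 3),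
        (y : Lp (EuclideanSpace ℝ (Fin 3)) 2 (volume : Measure (UnitAddTorus (Fin 3)))) ∈
          (Torus.galerkinSpace M : Submodule ℝ (Lp (EuclideanSpace ℝ (Fin 3)) 2 (volume : Measure (UnitAddTorus (Fin 3))))) →
        Γ₀ + S y ^ 2 * ‖y‖ ^ 2 / (4 * Real.pi ^ 2 * ((M : ℝ) ^ 2 + 1) - S y) ≤
          (Torus.eGradNormSq ((y : Lp (EuclideanSpace ℝ (Fin 3)) 2 (volume : Measure (UnitAddTorus (Fin 3)))) :
            UnitAddTorus (Fin 3) → EuclideanSpace ℝ (Fin 3))).toReal + Torus.nsGeneratorPairing 0 f y (Ψ.grad y) := by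
  rintro ⟨M, S, Ψ, hlow, -, -, hSM, hgal⟩
  obtain ⟨ρ, hρ, hsupp, hc, hinv⟩ := hcool M
  haveI := hρ
  exact no_galerkinCertificate_of_cool f M Γ₀ S Ψ hSM ρ hsupp hc (hinv Ψ hlow) hgal

/-- **Rungs must clear every steady Galerkin dodger of their resolution (Dirac instance).** If a state
`y⋆ ∈ H ∩ galerkinSpace M` is annihilated by the certificate's differential, `⟨f − B(y⋆,y⋆), Ψ'(y⋆)⟩ = 0` — as every
steady state of the `M`-Galerkin forced Euler ODE is, for every low-mode `Ψ` — then the level of any Galerkin certificate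
`(S, Ψ)` of resolution `M` is at most `‖∇y⋆‖²`: `Γ*(M) ≤ G_min(M)`. (No finiteness needed: at infinite
enstrophy the junk value `toReal ⊤ = 0` makes the hypothesis read `Γ ≤ 0`.) -/
theorem galerkinCertificate_le_enstrophy_of_steadyGalerkin
    (f : UnitAddTorus (Fin 3) → EuclideanSpace ℝ (Fin 3)) (M : ℕ) (Γ : ℝ)
    (S : Torus.energySpace (Fin 3) → ℝ) (Ψ : Torus.CylindricalTest (Fin 3))
    (hSM : ∀ v : Torus.energySpace (Fin 3), S v < 4 * Real.pi ^ 2 * ((M : ℝ) ^ 2 + 1))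
    (hgal : ∀ y : Torus.energySpace (Fin 3),
      (y : Lp (EuclideanSpace ℝ (Fin 3)) 2 (volume : Measure (UnitAddTorus (Fin 3)))) ∈
        (Torus.galerkinSpace M : Submodule ℝ (Lp (EuclideanSpace ℝ (Fin 3)) 2 (volume : Measure (UnitAddTorus (Fin 3))))) →
      Γ + S y ^ 2 * ‖y‖ ^ 2 / (4 * Real.pi ^ 2 * ((M : ℝ) ^ 2 + 1) - S y) ≤
        (Torus.eGradNormSq ((y : Lp (EuclideanSpace ℝ (Fin 3)) 2 (volume : Measure (UnitAddTorus (Fin 3)))) :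
          UnitAddTorus (Fin 3) → EuclideanSpace ℝ (Fin 3))).toReal + Torus.nsGeneratorPairing 0 f y (Ψ.grad y))
    (ystar : Torus.energySpace (Fin 3))
    (hmem : (ystar : Lp (EuclideanSpace ℝ (Fin 3)) 2 (volume : Measure (UnitAddTorus (Fin 3)))) ∈
        (Torus.galerkinSpace M : Submodule ℝ (Lp (EuclideanSpace ℝ (Fin 3)) 2 (volume : Measure (UnitAddTorus (Fin 3))))))
    (hsteady : Torus.nsGeneratorPairing 0 f ystar (Ψ.grad ystar) = 0) :
    Γ ≤ (Torus.eGradNormSq ((ystar : Lp (EuclideanSpace ℝ (Fin 3)) 2 (volume : Measure (UnitAddTorus (Fin 3)))) :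
        UnitAddTorus (Fin 3) → EuclideanSpace ℝ (Fin 3))).toReal := by
  have hpen : 0 ≤ S ystar ^ 2 * ‖ystar‖ ^ 2 / (4 * Real.pi ^ 2 * ((M : ℝ) ^ 2 + 1) - S ystar) :=
    div_nonneg (by positivity) (sub_nonneg.mpr (hSM ystar).le)
  have h := hgal ystar hmem
  rw [hsteady, add_zero] at h
  linarith

/-- The same read off the measure lemma: the Dirac mass at such a state is a cool annihilating measure, so in `ℝ≥0∞`
form `ofReal Γ ≤ ‖∇y⋆‖²` (consistency check of `galerkinCertificate_le_meanEnstrophy` on its simplest instance). -/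
theorem ofReal_level_le_enstrophy_of_steadyGalerkin
    (f : UnitAddTorus (Fin 3) → EuclideanSpace ℝ (Fin 3)) (M : ℕ) (Γ : ℝ)
    (S : Torus.energySpace (Fin 3) → ℝ) (Ψ : Torus.CylindricalTest (Fin 3))
    (hSM : ∀ v : Torus.energySpace (Fin 3), S v < 4 * Real.pi ^ 2 * ((M : ℝ) ^ 2 + 1))
    (hgal : ∀ y : Torus.energySpace (Fin 3),
      (y : Lp (EuclideanSpace ℝ (Fin 3)) 2 (volume : Measure (UnitAddTorus (Fin 3)))) ∈
        (Torus.galerkinSpace M : Submodule ℝ (Lp (EuclideanSpace ℝ (Fin 3)) 2 (volume : Measure (UnitAddTorus (Fin 3))))) →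
      Γ + S y ^ 2 * ‖y‖ ^ 2 / (4 * Real.pi ^ 2 * ((M : ℝ) ^ 2 + 1) - S y) ≤
        (Torus.eGradNormSq ((y : Lp (EuclideanSpace ℝ (Fin 3)) 2 (volume : Measure (UnitAddTorus (Fin 3)))) :
          UnitAddTorus (Fin 3) → EuclideanSpace ℝ (Fin 3))).toReal + Torus.nsGeneratorPairing 0 f y (Ψ.grad y))
    (ystar : Torus.energySpace (Fin 3))
    (hmem : (ystar : Lp (EuclideanSpace ℝ (Fin 3)) 2 (volume : Measure (UnitAddTorus (Fin 3)))) ∈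
        (Torus.galerkinSpace M : Submodule ℝ (Lp (EuclideanSpace ℝ (Fin 3)) 2 (volume : Measure (UnitAddTorus (Fin 3))))))
    (hfin : Torus.eGradNormSq ((ystar : Lp (EuclideanSpace ℝ (Fin 3)) 2 (volume : Measure (UnitAddTorus (Fin 3)))) :
        UnitAddTorus (Fin 3) → EuclideanSpace ℝ (Fin 3)) ≠ ⊤)
    (hsteady : Torus.nsGeneratorPairing 0 f ystar (Ψ.grad ystar) = 0) :
    ENNReal.ofReal Γ ≤ Torus.eGradNormSq ((ystar : Lp (EuclideanSpace ℝ (Fin 3)) 2 (volume : Measure (UnitAddTorus (Fin 3)))) :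
        UnitAddTorus (Fin 3) → EuclideanSpace ℝ (Fin 3)) := by
  have h := galerkinCertificate_le_enstrophy_of_steadyGalerkin f M Γ S Ψ hSM hgal ystar hmem hsteady
  exact (ENNReal.ofReal_le_ofReal h).trans (ENNReal.ofReal_toReal hfin).le

end Summit.AnomalousDissipation.AnomalousDissipation.Theorems.GPEulerCoercive.Negative

end
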